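import Summits.QuantumFields.YangMills.Theorems.UnitScaleTiltProp7CornerFrameLegsFlatMember
import HarnessLib

/-!
# Route `UnitScaleTilt`, crux K1 (stmt-QuantumFields-19200), LANE II (QB) ∕ (R-LEGS): `rlegs_flat` FROM THE TWO COUNTING ROWS — the sum over coarse bonds
# of the per-bond reading ✓`normSq_cornerFrameLegs_flat_member`, reduced by kernel to (L1) «box energy ≤ μ₁ · energy over the box's torus image» and (L2) «each fine site
# lies in ≤ μ₂ image boxes» (both pure lattice counting, displayed; texts = HOME `SIGNATURE0-F3b-…skeleton.px19g6.lean`)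
Cell `ym3-torus`, width seat `ym3-torus-px19` (gen 6; pen (R-LEGS)).  THEOREMS ONLY (0 `def`, 0 `sorry`); `--supports stmt-QuantumFields-19200 --as helper`, count-neutral.
YM₃ on T³ is a ladder rung (R3), not d = 4, not Clay; nothing here claims a stub, the crux or the gap.  CONDITIONAL on (L1), (L2) (displayed hypotheses).
PROVED (ns `…Prop7CornerFrameLegsFlatOfCounting`): ★★`rlegs_flat_Zd_of_counting` (torus gradient energy in SITE letters `Σ_x Σ_κ Σ_ν ‖X⟨x+e_ν,κ⟩ − X⟨x,κ⟩‖²`).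
References: T. Bałaban, CMP 98 (1985) 17–51 [Balaban1985Averaging] ((110)–(112) p.34, (125)–(127) pp.36–37, (160) p.42).
-/

set_option autoImplicit false

noncomputable section

open scoped BigOperators Matrix.Norms.L2Operator
open Finset

namespace Summit.QuantumFields.YangMills.Theorems.Prop7CornerFrameLegsFlatOfCounting

open Literature.MathematicalPhysics.QuantumFieldTheory.Balaban1983to89
open Literature.MathematicalPhysics.QuantumFieldTheory.Balaban1983to89.T3ContinuumYM3Torus
open Literature.MathematicalPhysics.QuantumFieldTheory.Balaban1983to89.B4Eq19LatticeOperators (Zd box unitVec mem_box)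
open B7Prop1Explicit (boxVec e)
open B7Prop3Flat (Fhat)
open B7Prop4Flat (linQIter)
open B10Eq27TorusAxialLog (transl)
open Summit.QuantumFields.YangMills.Theorems.Prop7SPrint (basePt)
open Summit.QuantumFields.YangMills.Theorems.Prop7SymAvgTw (coordT3)
open Summit.QuantumFields.YangMills.Theorems.Prop7SliceBoundBookkeeping (sum_sum_le_mul_sum_of_card_le)
open Summit.QuantumFields.YangMills.Theorems.Prop7CornerFrameLegsFlatMember (normSq_cornerFrameLegs_flat_member)

variable {F : T3Family} {n K : ℕ}

set_option maxHeartbeats 400000 in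
-- HEARTBEAT rule (README): the `r₁` letters and the top-box energies are long terms under a sum over coarse bonds; measured > 200k; decl-local.
/-- ★★ **`rlegs_flat` FROM THE TWO COUNTING ROWS.**  DISPLAYED: (L1) for every coarse site `y` and field `X`, the top-box energy of `X♯` is at most `μ₁` times the torus gradient
energy summed over the torus IMAGE of the box; (L2) every fine torus site lies in the image boxes of at most `μ₂` coarse bonds.  CONCLUSION: the flat corner-frame legs row in the
ℤ³-typed letters of ✓`normSq_cornerFrameLegs_flat_member`, `Cr = 2C₂(L)·μ₁·μ₂∕(L−2)`, K- and volume-free.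
[cite: Balaban1985Averaging, (110)–(112) p.34, (125)–(127) pp.36–37, (160) p.42] -/
theorem rlegs_flat_Zd_of_counting (μ₁ μ₂ : ℕ → ℝ) (hμ₁ : ∀ L, 0 ≤ μ₁ L)
    (hL1 : ∀ (F : T3Family) (n K : ℕ) (h : n ≤ K) (y : Site (F.P n) 0) (X : PBond (F.P K) 0 → Matrix (Fin 2) (Fin 2) ℂ),
      ∑ κ : Fin 3, ∑ z ∈ box (((((F.P K).L ^ (K - n) : ℕ) : ℤ)) • (fun i : Fin 3 => coordT3 F n K h y i)) (2 * (((F.P K).L ^ (K - n + 2) : ℕ) : ℤ)),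
          ∑ ν : Fin 3,
            (if z + unitVec ν ∈ box (((((F.P K).L ^ (K - n) : ℕ) : ℤ)) • (fun i : Fin 3 => coordT3 F n K h y i)) (2 * (((F.P K).L ^ (K - n + 2) : ℕ) : ℤ))
              then ‖X ⟨transl (basePt F n K) (z + unitVec ν), κ⟩ - X ⟨transl (basePt F n K) z, κ⟩‖ ^ 2 else 0)
        ≤ μ₁ F.L * ∑ x ∈ (box (((((F.P K).L ^ (K - n) : ℕ) : ℤ)) • (fun i : Fin 3 => coordT3 F n K h y i)) (2 * (((F.P K).L ^ (K - n + 2) : ℕ) : ℤ))).image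
                (fun z : Zd 3 => transl (basePt F n K) z),
              ∑ κ : Fin 3, ∑ ν : Fin 3, ‖X ⟨x.shift ν, κ⟩ - X ⟨x, κ⟩‖ ^ 2)
    (hL2 : ∀ (F : T3Family) (n K : ℕ) (h : n ≤ K) (x : Site (F.P K) 0),
      ((Finset.univ.filter fun c : PBond (F.P n) 0 =>
          x ∈ (box (((((F.P K).L ^ (K - n) : ℕ) : ℤ)) • (fun i : Fin 3 => coordT3 F n K h c.src i)) (2 * (((F.P K).L ^ (K - n + 2) : ℕ) : ℤ))).image
                (fun z : Zd 3 => transl (basePt F n K) z)).card : ℝ) ≤ μ₂ F.L) :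
    ∀ (L : ℕ), 1 < L → ∃ Cr : ℝ, 0 ≤ Cr ∧
    ∀ (F : T3Family), F.L = L → ∀ (n K : ℕ) (hnK : n < K) (X : PBond (F.P K) 0 → Matrix (Fin 2) (Fin 2) ℂ),
      ∑ c : PBond (F.P n) 0,
        ‖(∑ j ∈ Finset.range (K - n), Fhat (F.P K).L (linQIter (F.P K).L (fun (z : Zd 3) (κ : Fin 3) => X ⟨transl (basePt F n K) z, κ⟩) j)
              ((((F.P K).L : ℤ) ^ (K - n - j)) • (fun i : Fin 3 => coordT3 F n K hnK.le c.src i)))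
          - (∑ j ∈ Finset.range (K - n), Fhat (F.P K).L (linQIter (F.P K).L (fun (z : Zd 3) (κ : Fin 3) => X ⟨transl (basePt F n K) z, κ⟩) j)
              ((((F.P K).L : ℤ) ^ (K - n - j)) • (fun i : Fin 3 => coordT3 F n K hnK.le c.tgt i)))‖ ^ 2
        ≤ Cr * (F.L : ℝ) ^ (K - n) * ∑ x : Site (F.P K) 0, ∑ κ : Fin 3, ∑ ν : Fin 3, ‖X ⟨x.shift ν, κ⟩ - X ⟨x, κ⟩‖ ^ 2 := by
  intro L hL
  -- the L-only constant of the ℤ³ core at `N = 2`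
  set C : ℝ := 2 * (9 * (L : ℝ) ^ 2 * (6 * (L : ℝ) + 1) ^ 3 * 4
              * (3 * (10 * (2 : ℕ) + (5 * (2 : ℕ) * (L : ℝ) ^ 2 / 32) * ((L : ℝ) / (Real.sqrt L - 1) ^ 2 + 1)))) with hC
  have hs : 0 < Real.sqrt L - 1 := by
    have : (1 : ℝ) < Real.sqrt L := by
      rw [show (1 : ℝ) = Real.sqrt 1 by simp]; exact Real.sqrt_lt_sqrt (by norm_num) (by exact_mod_cast hL)
    linarith
  have hC0 : 0 ≤ C := by rw [hC]; positivity
  have hLm2' : (0 : ℝ) ≤ (L : ℝ) - 2 := by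
    have : (2 : ℝ) ≤ L := by exact_mod_cast hL
    linarith
  refine ⟨C * μ₁ L * max (μ₂ L) 0 / ((L : ℝ) - 2), div_nonneg (mul_nonneg (mul_nonneg hC0 (hμ₁ L)) (le_max_right _ _)) hLm2', ?_⟩
  intro F hF n K hnK X
  -- `3 ≤ L` at every member
  have hL3n : 3 ≤ F.L := by obtain ⟨r, hr⟩ := F.hL.1; have := F.hL.2; omega
  subst hF
  have hL3 : (3 : ℝ) ≤ (F.L : ℝ) := by exact_mod_cast hL3n
  have hLm2 : (0 : ℝ) < (F.L : ℝ) - 2 := by linarith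
  have hPL : ((F.P K).L : ℝ) = (F.L : ℝ) := rfl
  -- abbreviations
  set G : Site (F.P K) 0 → ℝ := fun x => ∑ κ : Fin 3, ∑ ν : Fin 3, ‖X ⟨x.shift ν, κ⟩ - X ⟨x, κ⟩‖ ^ 2 with hG
  have hG0 : ∀ x, 0 ≤ G x := fun x => Finset.sum_nonneg fun _ _ => Finset.sum_nonneg fun _ _ => sq_nonneg _
  set N : PBond (F.P n) 0 → Finset (Site (F.P K) 0) := fun c =>
    (box (((((F.P K).L ^ (K - n) : ℕ) : ℤ)) • (fun i : Fin 3 => coordT3 F n K hnK.le c.src i)) (2 * (((F.P K).L ^ (K - n + 2) : ℕ) : ℤ))).image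
      (fun z : Zd 3 => transl (basePt F n K) z) with hN
  -- per bond: F3a then (L1)
  have hbond : ∀ c : PBond (F.P n) 0,
      ‖(∑ j ∈ Finset.range (K - n), Fhat (F.P K).L (linQIter (F.P K).L (fun (z : Zd 3) (κ : Fin 3) => X ⟨transl (basePt F n K) z, κ⟩) j)
              ((((F.P K).L : ℤ) ^ (K - n - j)) • (fun i : Fin 3 => coordT3 F n K hnK.le c.src i)))
          - (∑ j ∈ Finset.range (K - n), Fhat (F.P K).L (linQIter (F.P K).L (fun (z : Zd 3) (κ : Fin 3) => X ⟨transl (basePt F n K) z, κ⟩) j)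
              ((((F.P K).L : ℤ) ^ (K - n - j)) • (fun i : Fin 3 => coordT3 F n K hnK.le c.tgt i)))‖ ^ 2
        ≤ C * ((F.L : ℝ) ^ (K - n) / ((F.L : ℝ) - 2)) * (μ₁ F.L * ∑ x ∈ N c, G x) := by
    intro c
    have h1 := normSq_cornerFrameLegs_flat_member (F := F) hnK.le c X
    rw [hPL] at h1
    refine h1.trans ?_
    rw [← hC]
    have hC0 : 0 ≤ C := by
      have hs : 0 < Real.sqrt (F.L : ℝ) - 1 := by
        have : (1 : ℝ) < Real.sqrt F.L := by
          rw [show (1 : ℝ) = Real.sqrt 1 by simp]; exact Real.sqrt_lt_sqrt (by norm_num) (by linarith)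
        linarith
      rw [hC]; positivity
    exact mul_le_mul_of_nonneg_left (hL1 F n K hnK.le c.src X) (by positivity)
  -- sum over bonds, (L2) through the covering-multiplicity lemma
  have hμ2' : 0 ≤ max (μ₂ F.L) 0 := le_max_right _ _
  obtain ⟨M, hM, hMμ⟩ : ∃ M : ℕ, (∀ x : Site (F.P K) 0, (Finset.univ.filter fun c : PBond (F.P n) 0 => x ∈ N c).card ≤ M) ∧ (M : ℝ) ≤ max (μ₂ F.L) 0 := by
    refine ⟨Nat.floor (max (μ₂ F.L) 0), fun x => ?_, Nat.floor_le hμ2'⟩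
    have := hL2 F n K hnK.le x
    exact Nat.le_floor (this.trans (le_max_left _ _))
  have hcov := sum_sum_le_mul_sum_of_card_le N G hG0 hM
  have hE0 : 0 ≤ ∑ x, G x := Finset.sum_nonneg fun x _ => hG0 x
  calc ∑ c : PBond (F.P n) 0, _
      ≤ ∑ c : PBond (F.P n) 0, C * ((F.L : ℝ) ^ (K - n) / ((F.L : ℝ) - 2)) * (μ₁ F.L * ∑ x ∈ N c, G x) := Finset.sum_le_sum fun c _ => hbond c
    _ = C * ((F.L : ℝ) ^ (K - n) / ((F.L : ℝ) - 2)) * μ₁ F.L * ∑ c : PBond (F.P n) 0, ∑ x ∈ N c, G x := by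
        rw [Finset.mul_sum]; exact Finset.sum_congr rfl fun c _ => by ring
    _ ≤ C * ((F.L : ℝ) ^ (K - n) / ((F.L : ℝ) - 2)) * μ₁ F.L * ((M : ℝ) * ∑ x, G x) := by
        refine mul_le_mul_of_nonneg_left hcov ?_
        have hC0 : 0 ≤ C := by
          have hs : 0 < Real.sqrt (F.L : ℝ) - 1 := by
            have : (1 : ℝ) < Real.sqrt F.L := by
              rw [show (1 : ℝ) = Real.sqrt 1 by simp]; exact Real.sqrt_lt_sqrt (by norm_num) (by linarith)
            linarith
          rw [hC]; positivity
        have := hμ₁ F.L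
        positivity
    _ ≤ C * ((F.L : ℝ) ^ (K - n) / ((F.L : ℝ) - 2)) * μ₁ F.L * (max (μ₂ F.L) 0 * ∑ x, G x) := by
        refine mul_le_mul_of_nonneg_left (mul_le_mul_of_nonneg_right hMμ hE0) ?_
        have hC0 : 0 ≤ C := by
          have hs : 0 < Real.sqrt (F.L : ℝ) - 1 := by
            have : (1 : ℝ) < Real.sqrt F.L := by
              rw [show (1 : ℝ) = Real.sqrt 1 by simp]; exact Real.sqrt_lt_sqrt (by norm_num) (by linarith)
            linarith
          rw [hC]; positivity
        have := hμ₁ F.L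
        positivity
    _ = C * μ₁ F.L * max (μ₂ F.L) 0 / ((F.L : ℝ) - 2) * (F.L : ℝ) ^ (K - n) * ∑ x, G x := by
        field_simp

end Summit.QuantumFields.YangMills.Theorems.Prop7CornerFrameLegsFlatOfCounting

end
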